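import Summits.Ventures.PackingBounds.Configurations.CohnLiVectors

/-!
# Cohn–Li kissing configurations (2024), II: the integer part and the sign part, counted

Framing: lottery ticket; floor = certified bounds/negative ranges. Venture `PackingBounds` (cell
`pub-packcert`, seat `pub-packcert-energy`).

For `n` kept coordinates `{0, …, n-1}` and a set `Z` of shortened coordinates (Cohn–Li 2024, §2:
`(n, Z) = (21, [21]), (20, [21]), (19, [19, 21])`, the remaining coordinates `≥ n` being punctured):
* `clInt n` = shape-`A` vectors on pairs `k < l < n` ∪ odd octad vectors on octads inside the kept coordinates
  (integer vectors of norm `32`, pairwise `ip ≤ 16`, vanishing beyond `n`);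
* `setS n Z` = sign vectors `svec n u` of the Golay codewords vanishing on `Z` (norm `n`), pairwise
  `2 · ip ≤ n` (the punctured/shortened code has minimum distance `≥ n/4`), and `ip ≤ 12` against `clInt n`.
Counts (kernel enumerations over `1104` / `759` / `4096` indices only): `|clInt 21| + |setS 21 [21]| =
840 + 26880 + 2048 = 29768`, `|clInt 20| + |setS 20 [21]| = 760 + 16640 + 2048 = 19448`,
`|clInt 19| + |setS 19 [19,21]| = 684 + 9984 + 1024 = 11692`.

## References
* H. Cohn, A. Li, *Improved kissing numbers in seventeen through twenty-one dimensions*, arXiv:2411.04916 (2024), §2, Table 2.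
-/

namespace Summit.Ventures.PackingBounds.Config.Leech

open Finset Golay

/-! ### Index sets -/

/-- Shape-`A` indices with both coordinates `< n`. -/
def idxAn (n : ℕ) : Finset ((Fin 24 × Fin 24) × (Bool × Bool)) := idxA.filter fun p => p.1.2.val < n

/-- Octads inside the kept coordinates `{0, …, n-1}`. -/
def octIn (n : ℕ) : Finset (Fin 759) := univ.filter fun o => ∀ j ∈ osupp o, j.val < n

/-- Golay messages whose codewords vanish on the shortened coordinates `Z`. -/
def msgZ (Z : List ℕ) : Finset ℕ := (range 4096).filter fun u => ∀ j ∈ Z, (cw u).testBit j = false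

/-- Shape-`A` vectors inside the kept coordinates. -/
def setAn (n : ℕ) : Finset (Fin 24 → ℤ) := (idxAn n).image fun p => avec p.1.1 p.1.2 p.2.1 p.2.2

/-- Odd octad vectors on octads inside the kept coordinates. -/
def setBn (n : ℕ) : Finset (Fin 24 → ℤ) := (octIn n ×ˢ range 128).image fun p => bvecOdd p.1 p.2

/-- The integer part: shape `A` inside the kept coordinates and odd octad vectors on octads inside them. -/
def clInt (n : ℕ) : Finset (Fin 24 → ℤ) := setAn n ∪ setBn n

/-- The sign part: sign vectors of the shortened/punctured Golay code. -/
def setS (n : ℕ) (Z : List ℕ) : Finset (Fin 24 → ℤ) := (msgZ Z).image (svec n)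

attribute [irreducible] idxAn octIn msgZ setAn setBn clInt setS

set_option maxRecDepth 100000 in
/-- Kernel counts of the shape-`A` index sets for `n = 19, 20, 21`. -/
theorem card_idxAn : (idxAn 19).card = 684 ∧ (idxAn 20).card = 760 ∧ (idxAn 21).card = 840 := by
  rw [idxAn, idxAn, idxAn, idxA]; decide +kernel

set_option maxRecDepth 100000 in
/-- Kernel counts of the octads inside the kept coordinates (one pass over the `759` octads). -/
theorem card_octIn : (octIn 19).card = 78 ∧ (octIn 20).card = 130 ∧ (octIn 21).card = 210 := by
  rw [octIn, octIn, octIn]; decide +kernel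

set_option maxRecDepth 100000 in
/-- Kernel counts of the shortened messages. -/
theorem card_msgZ : (msgZ [21]).card = 2048 ∧ (msgZ [19, 21]).card = 1024 := by
  rw [msgZ, msgZ]; decide +kernel

/-! ### Members -/

/-- Members of the shape-`A` part. -/
theorem mem_setAn {n : ℕ} {x : Fin 24 → ℤ} :
    x ∈ setAn n ↔ ∃ k l : Fin 24, ∃ a b : Bool, (k < l ∧ l.val < n) ∧ x = avec k l a b := by
  rw [setAn, idxAn, idxA]
  simp only [mem_image, mem_filter, mem_product, mem_univ, true_and, and_true, Prod.exists]
  constructor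
  · rintro ⟨k, l, a, b, h, rfl⟩; exact ⟨k, l, a, b, h, rfl⟩
  · rintro ⟨k, l, a, b, h, rfl⟩; exact ⟨k, l, a, b, h, rfl⟩

/-- Members of the odd-octad part. -/
theorem mem_setBn {n : ℕ} {x : Fin 24 → ℤ} :
    x ∈ setBn n ↔ ∃ o : Fin 759, ∃ v : ℕ, ((∀ j ∈ osupp o, j.val < n) ∧ v < 128) ∧ x = bvecOdd o v := by
  rw [setBn, octIn]
  simp only [mem_image, mem_product, mem_filter, mem_univ, mem_range, true_and, Prod.exists]
  constructor
  · rintro ⟨o, v, h, rfl⟩; exact ⟨o, v, h, rfl⟩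
  · rintro ⟨o, v, h, rfl⟩; exact ⟨o, v, h, rfl⟩

/-- Members of the integer part. -/
theorem mem_clInt {n : ℕ} {x : Fin 24 → ℤ} (hx : x ∈ clInt n) :
    (∃ k l : Fin 24, ∃ a b : Bool, k < l ∧ l.val < n ∧ x = avec k l a b) ∨
      (∃ o : Fin 759, ∃ v < 128, (∀ j ∈ osupp o, j.val < n) ∧ x = bvecOdd o v) := by
  rw [clInt, mem_union, mem_setAn, mem_setBn] at hx
  rcases hx with ⟨k, l, a, b, ⟨h1, h2⟩, rfl⟩ | ⟨o, v, ⟨h1, h2⟩, rfl⟩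
  · exact Or.inl ⟨k, l, a, b, h1, h2, rfl⟩
  · exact Or.inr ⟨o, v, h2, h1, rfl⟩

/-- Members of the sign part. -/
theorem mem_setS {n : ℕ} {Z : List ℕ} {x : Fin 24 → ℤ} (hx : x ∈ setS n Z) :
    ∃ u < 4096, (∀ j ∈ Z, (cw u).testBit j = false) ∧ x = svec n u := by
  rw [setS, msgZ] at hx
  simp only [mem_image, mem_filter, mem_range] at hx
  obtain ⟨u, ⟨hu, hZ⟩, rfl⟩ := hx
  exact ⟨u, hu, hZ, rfl⟩

/-! ### The integer part: norms, inner products, vanishing beyond `n` -/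

/-- Norm `32`. -/
theorem ip_self_of_mem_clInt {n : ℕ} {x : Fin 24 → ℤ} (hx : x ∈ clInt n) : ip x x = 32 := by
  rcases mem_clInt hx with ⟨k, l, a, b, hkl, _, rfl⟩ | ⟨o, v, _, _, rfl⟩
  · exact ip_avec_self hkl a b
  · exact ip_bvecOdd_self o v

/-- Pairwise `ip ≤ 16`. -/
theorem ip_le_of_mem_clInt {n : ℕ} {x y : Fin 24 → ℤ} (hx : x ∈ clInt n) (hy : y ∈ clInt n) (hne : x ≠ y) :
    ip x y ≤ 16 := by
  rcases mem_clInt hx with ⟨k, l, a, b, hkl, _, rfl⟩ | ⟨o, v, hv, _, rfl⟩ <;>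
    rcases mem_clInt hy with ⟨k', l', a', b', hkl', _, rfl⟩ | ⟨o', v', hv', _, rfl⟩
  · exact ip_avec_avec_le hkl hkl' hne
  · exact ip_avec_bvecOdd_le hkl a b o' v'
  · rw [ip_comm]; exact ip_avec_bvecOdd_le hkl' a' b' o v
  · by_cases hoo : o = o'
    · subst hoo; exact ip_bvecOdd_same_le o hv hv' hne
    · exact ip_bvecOdd_ne_le hoo v v'

/-- Coordinates of the integer part are `0, ±2, ±4`. -/
theorem apply_cases_of_mem_clInt {n : ℕ} {x : Fin 24 → ℤ} (hx : x ∈ clInt n) (j : Fin 24) :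
    x j = 0 ∨ x j = 2 ∨ x j = -2 ∨ x j = 4 ∨ x j = -4 := by
  rcases mem_clInt hx with ⟨k, l, a, b, hkl, _, rfl⟩ | ⟨o, v, _, _, rfl⟩
  · unfold avec
    rcases sgn_cases a with ha | ha <;> rcases sgn_cases b with hb | hb <;> rw [ha, hb] <;>
      by_cases h1 : j = k <;> by_cases h2 : j = l <;> simp [h1, h2] <;> omega
  · rcases bvecOdd_apply_cases o v j with ⟨_, h⟩ | ⟨_, h | h⟩ <;> simp [h]

/-- The integer part vanishes beyond the kept coordinates. -/
theorem apply_eq_zero_of_mem_clInt {n : ℕ} {x : Fin 24 → ℤ} (hx : x ∈ clInt n) {j : Fin 24} (hj : ¬ j.val < n) :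
    x j = 0 := by
  rcases mem_clInt hx with ⟨k, l, a, b, hkl, hl, rfl⟩ | ⟨o, v, _, hO, rfl⟩
  · by_contra h
    rcases (avec_ne_zero_iff hkl a b j).mp h with rfl | rfl
    · have := Fin.lt_def.mp hkl; omega
    · exact hj hl
  · exact bvecOdd_eq_zero fun h => hj (hO j h)

/-! ### The sign part -/

/-- Norm `n`. -/
theorem ip_self_of_mem_setS {n : ℕ} (hn : n ≤ 24) {Z : List ℕ} {s : Fin 24 → ℤ} (hs : s ∈ setS n Z) :
    ip s s = n := by
  obtain ⟨u, _, _, rfl⟩ := mem_setS hs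
  exact ip_svec_self hn u

/-- The sign part vanishes beyond the kept coordinates. -/
theorem apply_eq_zero_of_mem_setS {n : ℕ} {Z : List ℕ} {s : Fin 24 → ℤ} (hs : s ∈ setS n Z) {j : Fin 24}
    (hj : ¬ j.val < n) : s j = 0 := by
  obtain ⟨u, _, _, rfl⟩ := mem_setS hs
  simp [svec, hj]

/-- Coordinates `< n` of the sign part are `±1`. -/
theorem apply_cases_of_mem_setS {n : ℕ} {Z : List ℕ} {s : Fin 24 → ℤ} (hs : s ∈ setS n Z) {j : Fin 24}
    (hj : j.val < n) : s j = 1 ∨ s j = -1 := by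
  obtain ⟨u, _, _, rfl⟩ := mem_setS hs
  rcases svec_apply_cases n u j with ⟨_, h⟩ | ⟨h, _⟩
  · exact h
  · exact absurd hj h

/-- Integer part against sign part: `ip ≤ 12`. -/
theorem ip_le_of_mem_clInt_setS {n : ℕ} {Z : List ℕ} {x s : Fin 24 → ℤ} (hx : x ∈ clInt n) (hs : s ∈ setS n Z) :
    ip x s ≤ 12 := by
  obtain ⟨u, hu, _, rfl⟩ := mem_setS hs
  rcases mem_clInt hx with ⟨k, l, a, b, hkl, _, rfl⟩ | ⟨o, v, _, hO, rfl⟩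
  · exact (ip_avec_svec_le hkl a b n u).trans (by norm_num)
  · exact ip_bvecOdd_svec_le o v hO hu

/-- If two sign vectors on `n ≥ 17` kept coordinates agree, the messages agree. -/
theorem svec_inj {n : ℕ} (hn17 : 17 ≤ n) (hn : n ≤ 24) {u u' : ℕ} (hu : u < 4096) (hu' : u' < 4096)
    (h : svec n u = svec n u') : u = u' := by
  by_contra hne
  have h8 := wt_cw_xor_ge hu hu' hne
  -- the codeword of `u ⊕ u'` is supported on the coordinates `≥ n`
  have hsub : supp (cw (u ^^^ u')) ⊆ univ.filter fun j : Fin 24 => ¬ j.val < n := by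
    intro j hj
    rw [mem_supp, cw_xor, Nat.testBit_xor] at hj
    rw [mem_filter]
    refine ⟨mem_univ _, fun hjn => ?_⟩
    have e := congrFun h j
    simp only [svec, hjn, if_true] at e
    have := sgn_injective e
    rw [this] at hj
    simp at hj
  have hcard : (univ.filter fun j : Fin 24 => ¬ j.val < n).card = 24 - n := by
    rw [Finset.filter_not, Finset.card_univ_sdiff, card_filter_val_lt hn]; simp
  have := Finset.card_le_card hsub
  unfold wt at h8
  omega

/-- `|setS n Z| = |msgZ Z|` for `17 ≤ n ≤ 24`. -/
theorem card_setS {n : ℕ} (hn17 : 17 ≤ n) (hn : n ≤ 24) (Z : List ℕ) : (setS n Z).card = (msgZ Z).card := by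
  rw [setS, card_image_of_injOn]
  intro u hu u' hu' h
  have hu4 : u < 4096 := by rw [msgZ] at hu; exact mem_range.mp (mem_filter.mp hu).1
  have hu4' : u' < 4096 := by rw [msgZ] at hu'; exact mem_range.mp (mem_filter.mp hu').1
  exact svec_inj hn17 hn hu4 hu4' h

/-- **Minimum distance of the punctured/shortened code**: for distinct messages vanishing on `Z`, the codeword of
`u ⊕ u'` has at least `8 - p` ones among the kept coordinates, `p` = number of punctured coordinates
(those `≥ n` outside `Z`). -/
theorem wtK_ge {n : ℕ} {Z : List ℕ} {u u' : ℕ} (hu : u < 4096) (hu' : u' < 4096) (hne : u ≠ u')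
    (hZ : ∀ j ∈ Z, (cw u).testBit j = false) (hZ' : ∀ j ∈ Z, (cw u').testBit j = false) :
    8 ≤ wtK n (cw (u ^^^ u')) + (univ.filter fun j : Fin 24 => ¬ j.val < n ∧ j.val ∉ Z).card := by
  have h8 := wt_cw_xor_ge hu hu' hne
  have h1 := wtK_add_card_ge n (cw (u ^^^ u'))
  have h2 : (univ.filter fun j : Fin 24 => ¬ j.val < n ∧ (cw (u ^^^ u')).testBit j.val = true).card ≤
      (univ.filter fun j : Fin 24 => ¬ j.val < n ∧ j.val ∉ Z).card := by
    apply Finset.card_le_card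
    intro j hj
    rw [mem_filter] at hj ⊢
    refine ⟨hj.1, hj.2.1, fun hjZ => ?_⟩
    have := hj.2.2
    rw [cw_xor, Nat.testBit_xor, hZ _ hjZ, hZ' _ hjZ] at this
    simp at this
  omega

/-- **Sign part pairwise**: `2 · ip ≤ n` for distinct sign vectors, provided `n + 4p ≤ 32` (`p` punctured
coordinates; Cohn–Li: minimum distance `≥ n/4`). -/
theorem two_ip_le_of_mem_setS {n : ℕ} (hn : n ≤ 24) {Z : List ℕ} {p : ℕ}
    (hp : (univ.filter fun j : Fin 24 => ¬ j.val < n ∧ j.val ∉ Z).card = p) (hnp : n + 4 * p ≤ 32)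
    {s s' : Fin 24 → ℤ} (hs : s ∈ setS n Z) (hs' : s' ∈ setS n Z) (hne : s ≠ s') : 2 * ip s s' ≤ n := by
  obtain ⟨u, hu, hZ, rfl⟩ := mem_setS hs
  obtain ⟨u', hu', hZ', rfl⟩ := mem_setS hs'
  have huu : u ≠ u' := fun h => hne (by rw [h])
  have hw := wtK_ge (n := n) hu hu' huu hZ hZ'
  rw [hp] at hw
  have := ip_svec_svec_le hn (u := u) (u' := u') (w := 8 - p) (by omega)
  omega

/-! ### Cardinality of the integer part and disjointness -/

/-- `|setAn n| = |idxAn n|`. -/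
theorem card_setAn (n : ℕ) : (setAn n).card = (idxAn n).card := by
  rw [setAn, card_image_of_injOn]
  rintro ⟨⟨k, l⟩, ⟨a, b⟩⟩ hp ⟨⟨k', l'⟩, ⟨a', b'⟩⟩ hp' h
  have hkl : k < l := by rw [idxAn] at hp; have := (mem_filter.mp hp).1; simpa [idxA] using this
  have hkl' : k' < l' := by rw [idxAn] at hp'; have := (mem_filter.mp hp').1; simpa [idxA] using this
  obtain ⟨e1, e2, e3, e4⟩ := avec_inj hkl hkl' h
  subst e1 e2 e3 e4; rfl

/-- `|setBn n| = 128 |octIn n|`. -/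
theorem card_setBn (n : ℕ) : (setBn n).card = (octIn n).card * 128 := by
  rw [setBn, card_image_of_injOn, card_product, card_range]
  rintro ⟨o, v⟩ hp ⟨o', v'⟩ hp' h
  have hv : v < 128 := mem_range.mp (mem_product.mp hp).2
  have hv' : v' < 128 := mem_range.mp (mem_product.mp hp').2
  obtain ⟨e1, e2⟩ := bvecOdd_inj hv hv' h
  subst e1 e2; rfl

/-- Shape `A` and odd shape `B` are disjoint (`±4` is not an odd-octad coordinate). -/
theorem disjoint_setAn_setBn (n : ℕ) : Disjoint (setAn n) (setBn n) := by
  rw [Finset.disjoint_left]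
  intro x hA hB
  obtain ⟨k, l, a, b, ⟨hkl, _⟩, rfl⟩ := mem_setAn.mp hA
  obtain ⟨o, v, _, h⟩ := mem_setBn.mp hB
  have e := congrFun h k
  rw [avec_apply_left hkl] at e
  rcases sgn_cases a with ha | ha <;> rw [ha] at e <;>
    rcases bvecOdd_apply_cases o v k with ⟨_, h1⟩ | ⟨_, h1 | h1⟩ <;> omega

/-- `|clInt n| = |idxAn n| + 128 |octIn n|`. -/
theorem card_clInt (n : ℕ) : (clInt n).card = (idxAn n).card + (octIn n).card * 128 := by
  rw [clInt, card_union_eq_card_add_card.mpr (disjoint_setAn_setBn n), card_setAn, card_setBn]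

/-- The counts of the three Cohn–Li configurations (integer part + sign part). [Cohn–Li 2024, Table 2] -/
theorem card_cohnLi :
    (clInt 21).card + (setS 21 [21]).card = 29768 ∧ (clInt 20).card + (setS 20 [21]).card = 19448 ∧
      (clInt 19).card + (setS 19 [19, 21]).card = 11692 := by
  obtain ⟨a19, a20, a21⟩ := card_idxAn
  obtain ⟨o19, o20, o21⟩ := card_octIn
  obtain ⟨m21, m1921⟩ := card_msgZ
  rw [card_clInt, card_clInt, card_clInt, card_setS (by norm_num) (by norm_num), card_setS (by norm_num) (by norm_num),
    card_setS (by norm_num) (by norm_num), a19, a20, a21, o19, o20, o21, m21, m1921]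
  norm_num

end Summit.Ventures.PackingBounds.Config.Leech
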